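import Summits.FinalStateConjecture.FinalStateConjecture.Theses.PhotonSphereChannels

/-!
# Strategy census s3 (crux `ChannelsResolveTameDevelopmentsR`, stmt-FinalStateConjecture-17430) — kernel-checked part

Strategist seat `cstrat-stmt-FinalStateConjecture-17430-s3` (independent census, family `s`).
This file carries the Lean content of the census heading **"weaker intermediate from the summit"**
(`STRATEGY-CENSUS-s3.md` §1):

* `RouteQ` / `SummitP` — the property `Q` of crux K3 `TameCensorship` and the property `P` of the
  summit `FinalStateConjecture`, copied verbatim and certified by `Iff.rfl`
  (`tameCensorship_iff`, `finalStateConjecture_iff`).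
* The deciding theorem `closes` consumes tame genericity ONLY through monotonicity, which needs the
  pointwise inclusion `Q ⊆ P` on admissible data, i.e. the crux `K2R` (`subset_of_k2R`).
* The two-case reading of genericity gives the WEAKEST typed replacement of `K2R` that still closes
  with K3 VERBATIM: `SettlesAlongCensorshipCurves` (X₁: `Q → P` only on the punctured tame curves
  through NON-tame data all of whose other members are tame) and `TameNonSettlingIsNonGeneric`
  (X₂: the bad tame data `Q ∧ ¬P` have tame codimension ≥ 1 relative to `P`), with
  `finalStateConjecture_of_weakIntermediate : X₁ → X₂ → TameCensorship → FinalStateConjecture`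
  (sorry-free) and `weakIntermediate_of_k2R : K2R → X₁ ∧ X₂`.

Reading (census §1): `K2R` is OVER-STRONG for its own route by exactly `K2R ∖ (X₁ ∧ X₂)`; but X₁ is
`Φ` in costume unless the non-tame locus is curve-isolated, and X₂ is an INSTABILITY statement for
exotic tame asymptotics — a different route (`closes` would change), not a strategist move on this
crux. No `sorry` in this file.
-/

noncomputable section

open scoped Manifold ContDiff Topology
open Filter Set Literature.Geometry.Lorentzian

namespace Summit.FinalStateConjecture.FinalStateConjecture.Cruxes.ChannelsResolveTameDevelopmentsR.CensusS3

open Summit.FinalStateConjecture.FinalStateConjecture.Theses.PhotonSphereChannels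
  (ChannelsResolveTameDevelopmentsR UniformPhotonSphereChannelsR TameCensorship
    UniformPhotonSphereChannelsR_holds)

/-! ### §0 Abstract genericity bookkeeping (any admissible class `𝓓`, any properties `P Q`) -/

section Abstract

variable {X : Type} [TopologicalSpace X] [ChartedSpace E3 X] [IsManifold (𝓡 3) ∞ X]

/-- **X₁ (abstract): curve transfer.** Along every injective, immersed, tame one-parameter family of
`𝓓`-data whose base member FAILS `Q` and all of whose other members satisfy `Q`, the other members
satisfy `P`. (These are exactly the witness families K3 can hand to `closes`.) [folklore] -/
def CurveTransfer (𝓓 : Set (InitialDataSet (𝓡 3) X)) (P Q : InitialDataSet (𝓡 3) X → Prop) : Prop :=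
  ∀ (e : AFEnd X) (F : EuclideanSpace ℝ (Fin 1) → InitialDataSet (𝓡 3) X),
    InitialDataSet.IsTameDataFamily e 1 F → InitialDataSet.IsImmersedAtZero 1 F →
      Function.Injective F → (∀ c, F c ∈ 𝓓) → ¬ Q (F 0) → (∀ c ≠ 0, Q (F c)) → ∀ c ≠ 0, P (F c)

/-- **X₂ (abstract): the bad set `Q ∧ ¬P` is tame-non-generic relative to `P`.** Through every
`𝓓`-datum satisfying `Q` but not `P` passes an injective immersed tame family of `𝓓`-data all of
whose OTHER members satisfy `P`. [folklore] -/
def BadIsNonGeneric (𝓓 : Set (InitialDataSet (𝓡 3) X)) (P Q : InitialDataSet (𝓡 3) X → Prop) :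
    Prop :=
  ∀ d ∈ 𝓓, Q d → ¬ P d →
    ∃ (e : AFEnd X) (F : EuclideanSpace ℝ (Fin 1) → InitialDataSet (𝓡 3) X),
      InitialDataSet.IsTameDataFamily e 1 F ∧ InitialDataSet.IsImmersedAtZero 1 F ∧ F 0 = d ∧
        Function.Injective F ∧ (∀ c, F c ∈ 𝓓) ∧ ∀ c ≠ 0, P (F c)

/-- **Two-case transport of tame genericity.** `generic Q ∧ X₁ ∧ X₂ ⇒ generic P`: an exceptional
datum of `P` either fails `Q` (use K3's family and X₁) or satisfies `Q` (use X₂'s family). This is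
the most general way a `closes`-type theorem can consume `IsTameChristodoulouGeneric … Q 1` for a
FIXED `Q`, the notion carrying no openness/transversality structure. [folklore] -/
theorem generic_of_curveTransfer_of_badIsNonGeneric {𝓓 : Set (InitialDataSet (𝓡 3) X)}
    {P Q : InitialDataSet (𝓡 3) X → Prop}
    (hQ : InitialDataSet.IsTameChristodoulouGeneric 𝓓 Q 1) (h₁ : CurveTransfer 𝓓 P Q)
    (h₂ : BadIsNonGeneric 𝓓 P Q) : InitialDataSet.IsTameChristodoulouGeneric 𝓓 P 1 := by
  intro d hd
  by_cases hQd : Q d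
  · obtain ⟨e, F, hF, himm, h0, hinj, hadm, hP⟩ := h₂ d hd.1 hQd hd.2
    exact ⟨e, F, hF, himm, h0, hinj, hadm, fun c hc hmem => hmem.2 (hP c hc)⟩
  · obtain ⟨e, F, hF, himm, h0, hinj, hadm, hexc⟩ := hQ d ⟨hd.1, hQd⟩
    have hQF : ∀ c ≠ 0, Q (F c) := fun c hc => by
      by_contra h
      exact hexc c hc ⟨hadm c, h⟩
    have hQ0 : ¬ Q (F 0) := by rw [h0]; exact hQd
    exact ⟨e, F, hF, himm, h0, hinj, hadm,
      fun c hc hmem => hmem.2 (h₁ e F hF himm hinj hadm hQ0 hQF c hc)⟩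

/-- Pointwise inclusion gives X₁. [folklore] -/
theorem curveTransfer_of_subset {𝓓 : Set (InitialDataSet (𝓡 3) X)}
    {P Q : InitialDataSet (𝓡 3) X → Prop} (h : ∀ d ∈ 𝓓, Q d → P d) : CurveTransfer 𝓓 P Q :=
  fun _ F _ _ _ hadm _ hQF c hc => h (F c) (hadm c) (hQF c hc)

/-- Pointwise inclusion gives X₂ (vacuously: the bad set is empty). [folklore] -/
theorem badIsNonGeneric_of_subset {𝓓 : Set (InitialDataSet (𝓡 3) X)}
    {P Q : InitialDataSet (𝓡 3) X → Prop} (h : ∀ d ∈ 𝓓, Q d → P d) : BadIsNonGeneric 𝓓 P Q :=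
  fun d hd hQd hPd => absurd (h d hd hQd) hPd

/-- The monotonicity used by `closes` is the special case X₁, X₂ ⇐ `Q ⊆ P`. [folklore] -/
theorem generic_mono {𝓓 : Set (InitialDataSet (𝓡 3) X)} {P Q : InitialDataSet (𝓡 3) X → Prop}
    (h : ∀ d ∈ 𝓓, Q d → P d) (hQ : InitialDataSet.IsTameChristodoulouGeneric 𝓓 Q 1) :
    InitialDataSet.IsTameChristodoulouGeneric 𝓓 P 1 :=
  generic_of_curveTransfer_of_badIsNonGeneric hQ (curveTransfer_of_subset h)
    (badIsNonGeneric_of_subset h)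

end Abstract

/-! ### §1 The route's `Q` (K3) and the summit's `P`, verbatim -/

/-- The property `Q` of K3 `TameCensorship` (route PhotonSphereChannels, rev 16): MGHD exists, and
every MGHD has complete `𝓘⁺`, (i) no extremal remnant, (ii) tame outer region — copied verbatim
from the route file. [folklore] -/
def RouteQ (X : Type) [TopologicalSpace X] [ChartedSpace E3 X] [IsManifold (𝓡 3) ∞ X] [T2Space X]
    [SecondCountableTopology X] [ConnectedSpace X]
    (D : InitialDataSet (𝓡 3) X) : Prop :=
  (∃ 𝒟 : Literature.Geometry.Lorentzian.VacuumCauchyDevelopment D, 𝒟.IsMaximal) ∧ ∀ 𝒟 : Literature.Geometry.Lorentzian.VacuumCauchyDevelopment D, 𝒟.IsMaximal → _root_.Summit.FinalStateConjecture.HasCompleteNullInfinity 𝒟.toCauchyDevelopment ∧ ((∀ (Λ : Literature.Geometry.Lorentzian.lorentzGroup) (c : Literature.Geometry.Lorentzian.E4) (M a : ℝ), Literature.Geometry.Lorentzian.Kerr.IsExtremal M a → ¬ ∃ (τ₀ : ℝ) (Ψ : (Literature.Geometry.Lorentzian.boostedKerrBackground Λ c M a).domain → 𝒟.carrier), 𝒟.toSpacetime.IsLateChart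 (Literature.Geometry.Lorentzian.boostedKerrBackground Λ c M a) Set.univ τ₀ Ψ ∧ ∀ R : ℝ, Filter.Tendsto (fun τ => 𝒟.toSpacetime.truncDeviationCk (Literature.Geometry.Lorentzian.boostedKerrBackground Λ c M a) Ψ 2 R τ) Filter.atTop (nhds 0)) ∧ ∀ [𝒟.metric.HasLeviCivita], let outer : Set 𝒟.carrier := 𝒟.metric.causalFuture 𝒟.timeOrientation (Set.range 𝒟.embed) ∩ {q | ∃ (p : X) (γ : ℝ → 𝒟.carrier) (dom : Set ℝ), 𝒟.metric.IsNormalisedNullRayFrom 𝒟.timeOrientation 𝒟.embed 𝒟.normal p γ dom ∧ ¬ BddAbove dom ∧ q ∈ 𝒟.metric.chronologicalPast 𝒟.timeOrientation (γ '' (dom ∩ Set.Ici 0))}; ∃ r₀ : ℝ, 0 < r₀ ∧ ∃ Λ : NNReal, ∀ q ∈ outer, let U : TopologicalSpace.Opens Literature.Geometry.Lorentzian.E4 := ⟨Metric.ball (0 : Literature.Geometry.Lorentzian.E4) r₀, Metric.isOpen_ball⟩; ∃ Ψ : U → 𝒟.carrier, 𝒟.toSpacetime.IsLateChart (Literature.Geometry.Lorentzian.Minkowski.backgroundOn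 U) Set.univ (-r₀) Ψ ∧ (∃ x : U, (x : Literature.Geometry.Lorentzian.E4) = 0 ∧ Ψ x = q) ∧ Literature.Geometry.Lorentzian.supCkENorm (U : Set Literature.Geometry.Lorentzian.E4) 3 (𝒟.toSpacetime.deviationExtend (Literature.Geometry.Lorentzian.Minkowski.backgroundOn U) Ψ) ≤ (Λ : ENNReal) ∧ Literature.Geometry.Lorentzian.supCkENorm (U : Set Literature.Geometry.Lorentzian.E4) 0 (𝒟.toSpacetime.deviationExtend (Literature.Geometry.Lorentzian.Minkowski.backgroundOn U) Ψ) ≤ 1 / 2)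

/-- The property `P` of the summit `FinalStateConjecture` (Statement.lean): MGHD exists, and every
MGHD has complete `𝓘⁺` and settles down (T2). Copied verbatim. [cite: DafermosLuk2017, Conjecture 1] -/
def SummitP (X : Type) [TopologicalSpace X] [ChartedSpace E3 X] [IsManifold (𝓡 3) ∞ X] [T2Space X]
    [SecondCountableTopology X] [ConnectedSpace X]
    (D : InitialDataSet (𝓡 3) X) : Prop :=
  (∃ 𝒟 : VacuumCauchyDevelopment D, 𝒟.IsMaximal) ∧
        ∀ 𝒟 : VacuumCauchyDevelopment D, 𝒟.IsMaximal →
          Summit.FinalStateConjecture.HasCompleteNullInfinity 𝒟.toCauchyDevelopment ∧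
            ∃ (O : Set 𝒟.carrier) (d : FinalStateDecomposition 𝒟.toSpacetime O 2),
              (∀ i, Kerr.IsSubextremal (d.mass i) (d.spin i)) ∧
                O = Summit.FinalStateConjecture.exteriorOf 𝒟.toCauchyDevelopment d.charted ∧
                  Summit.FinalStateConjecture.RaysStayInClosure 𝒟.toCauchyDevelopment O ∧
                    Summit.FinalStateConjecture.HasExhaustiveCharts d ∧
                      Summit.FinalStateConjecture.IsFutureOriented d

/-- Certification of the copy: K3 is tame genericity of `RouteQ`. [folklore] -/
theorem tameCensorship_iff :
    TameCensorship ↔ ∀ (X : Type) [TopologicalSpace X] [ChartedSpace E3 X] [IsManifold (𝓡 3) ∞ X] [T2Space X]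
    [SecondCountableTopology X] [ConnectedSpace X],
      InitialDataSet.IsTameChristodoulouGeneric (admissibleVacuumData X) (RouteQ X) 1 :=
  Iff.rfl

/-- Certification of the copy: the summit is tame genericity of `SummitP`. [folklore] -/
theorem finalStateConjecture_iff :
    _root_.FinalStateConjecture ↔ ∀ (X : Type) [TopologicalSpace X] [ChartedSpace E3 X] [IsManifold (𝓡 3) ∞ X] [T2Space X]
    [SecondCountableTopology X] [ConnectedSpace X],
      InitialDataSet.IsTameChristodoulouGeneric (admissibleVacuumData X) (SummitP X) 1 :=
  Iff.rfl

/-! ### §2 The weakest replacement of K2R that closes with K3 verbatim -/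

/-- **X₁ — `SettlesAlongCensorshipCurves`.** For every `Σ`: along every injective immersed tame
admissible curve whose base datum is NOT tame-censored (`¬ Q`) and all of whose other members are,
the other members settle (`P`). `Φ = K2R` restricted to the punctured K3-witness curves. [folklore] -/
def SettlesAlongCensorshipCurves : Prop :=
  ∀ (X : Type) [TopologicalSpace X] [ChartedSpace E3 X] [IsManifold (𝓡 3) ∞ X] [T2Space X]
    [SecondCountableTopology X] [ConnectedSpace X],
    CurveTransfer (admissibleVacuumData X) (SummitP X) (RouteQ X)

/-- **X₂ — `TameNonSettlingIsNonGeneric`.** For every `Σ`: through every admissible datum that is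
tame-censored (`Q`) but does NOT settle (`¬ P`) passes an injective immersed tame admissible curve
all of whose other members settle: exotic tame asymptotics are tame-non-generic. An INSTABILITY
statement, vacuous under K2R. [folklore] -/
def TameNonSettlingIsNonGeneric : Prop :=
  ∀ (X : Type) [TopologicalSpace X] [ChartedSpace E3 X] [IsManifold (𝓡 3) ∞ X] [T2Space X]
    [SecondCountableTopology X] [ConnectedSpace X],
    BadIsNonGeneric (admissibleVacuumData X) (SummitP X) (RouteQ X)

/-- **The weak intermediate closes with K3 verbatim** (same shape as the route's `closes`, with
`K2R` replaced by `X₁ ∧ X₂`; `K1R` is not needed). Sorry-free. [folklore] -/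
theorem finalStateConjecture_of_weakIntermediate (h₁ : SettlesAlongCensorshipCurves)
    (h₂ : TameNonSettlingIsNonGeneric) (h₃ : TameCensorship) : _root_.FinalStateConjecture := by
  rw [finalStateConjecture_iff]
  intro X _ _ _ _ _ _
  exact generic_of_curveTransfer_of_badIsNonGeneric (tameCensorship_iff.mp h₃ X) (h₁ X) (h₂ X)

/-- **K2R gives the pointwise inclusion `Q ⊆ P`** on admissible data (the body of the route's
`closes` after `mono`; K1R is a theorem, `UniformPhotonSphereChannelsR_holds`). [folklore] -/
theorem subset_of_k2R (h₂ : ChannelsResolveTameDevelopmentsR) :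
    ∀ (X : Type) [TopologicalSpace X] [ChartedSpace E3 X] [IsManifold (𝓡 3) ∞ X] [T2Space X]
    [SecondCountableTopology X] [ConnectedSpace X],
      ∀ D ∈ admissibleVacuumData X, RouteQ X D → SummitP X D := by
  intro X _ _ _ _ _ _ D hD hQ
  obtain ⟨hex, hQ⟩ := hQ
  refine ⟨hex, fun 𝒟 hmax => ?_⟩
  obtain ⟨hcomp, htame⟩ := hQ 𝒟 hmax
  obtain ⟨O, d, hO, hrays, hexh, hfo⟩ :=
    h₂ UniformPhotonSphereChannelsR_holds X D hD 𝒟 hmax hcomp htame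
  refine ⟨hcomp, O, d, fun i => ?_, hO, hrays, hexh, hfo⟩
  rcases lt_or_eq_of_le (d.abs_spin_le_mass i) with hlt | heq
  · exact hlt
  · exact absurd ⟨d.τ₀, d.chart i, ⟨(d.isLateChart i).contMDiff, (d.isLateChart i).isOpenEmbedding,
        Set.subset_univ _⟩, d.tendsto_truncDeviationCk i⟩
      (htame.1 (d.motion i).1 (d.motion i).2 (d.mass i) (d.spin i) ⟨heq, d.mass_pos i⟩)

/-- **K2R ⇒ X₁ ∧ X₂**: the weak intermediate is implied by the crux (strictly weaker on paper:
X₂ asks only non-genericity of the bad tame data, X₁ only settling along K3-witness curves).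
[folklore] -/
theorem weakIntermediate_of_k2R (h₂ : ChannelsResolveTameDevelopmentsR) :
    SettlesAlongCensorshipCurves ∧ TameNonSettlingIsNonGeneric :=
  ⟨fun X _ _ _ _ _ _ => curveTransfer_of_subset (subset_of_k2R h₂ X),
    fun X _ _ _ _ _ _ => badIsNonGeneric_of_subset (subset_of_k2R h₂ X)⟩

/-- Consistency with the route: the route's own assembly shape, recovered through the weak
intermediate (so nothing is lost by the factorisation). [folklore] -/
theorem finalStateConjecture_of_k2R_of_tameCensorship (h₂ : ChannelsResolveTameDevelopmentsR)
    (h₃ : TameCensorship) : _root_.FinalStateConjecture :=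
  finalStateConjecture_of_weakIntermediate (weakIntermediate_of_k2R h₂).1
    (weakIntermediate_of_k2R h₂).2 h₃

end Summit.FinalStateConjecture.FinalStateConjecture.Cruxes.ChannelsResolveTameDevelopmentsR.CensusS3

end
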